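import Literature.NumberTheory.Automorphic.WhittakerBiEquivariantSupport
import HarnessLib

/-!
# Support of bi-`ψ`-equivariant Whittaker functions on a corner: the level form

Topic `NumberTheory/Automorphic`; namespace `Literature.NumberTheory.Automorphic.WhittakerSupport`.
Theorems only (no definition, no named fact). A sharpening of the support theorem
`exists_eq_unipotent_mul_integral_of_mem_cornerGL` of `WhittakerBiEquivariantSupport`, needed for the
bad finite places of a PAIR of cusp forms (Mœglin–Waldspurger (1989), Appendice, Corollaire (i)(b), via
Jacquet–Piatetski-Shapiro–Shalika (1983), (2.7): at a non-archimedean place the local Rankin–Selberg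
integral of suitable data "is a non-zero constant"). Keep the hypotheses `IsSpreadWhittaker ψ t M W` of
that file (`W` left `ψ_N`-equivariant, right `ψ_N`-equivariant under the unipotents `u` with `d⁻¹ u d`
integral, right invariant under the `κ` with `d⁻¹ κ^{±1} d ≡ 1 (mod 𝔭^M)`, `d = diag(t)` with
decreasing valuations and gaps `exp(M - c₀)`).

* `exists_eq_unipotent_mul_level_of_mem_cornerGL` — if `g` lies in a proper corner `GL_d × 1_{N-d}`
  and `W(g) ≠ 0`, then `g = u k` with `u ∈ N_N(F)` and `k` in the principal congruence subgroup
  `K(𝔭^M)` and **invisible to `W`**: `W(y k) = W(y)` for all `y`. (The induction of the source theorem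
  already produces `k` as a product of row matrices `1 + e_i ⊗ D` with `|D| ≤ exp(-M)`, each in the
  level set of `IsSpreadWhittaker.level`; the source only recorded `k ∈ GL_N(𝒪)`.)
* `exists_eq_unipotent_mul_level_of_lastRow` — the same conclusion for ANY `g ∈ GL_{n+1}(F)` whose
  last row is `≡ e_{n+1} (mod 𝔭^{m₀})` with `exp(-m₀) |t₀| ≤ exp(-M) |t_n|` (the points selected by
  a test function supported on `e_{n+1} + 𝔭^{m₀} 𝒪^{n+1}`): remove the last row by a row matrix of
  the level set, split off the corner `GL_n`, and apply the first theorem.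
* `apply_eq_whittakerCharFun_mul_apply_one_of_lastRow` — consequently `W(g) = ψ_N(u) W(1)` at such a
  point: on the thin set, `W` is `W(1)` times a unitary phase, and a SECOND function `W'` which is
  merely right `K(𝔭^M)`-invariant and left `ψ_N`-equivariant takes the value `ψ_N(u) W'(1)` there
  (`apply_eq_whittakerCharFun_mul_apply_one_of_eq_mul`) — the device making the bad-place part of the
  unfolded Rankin–Selberg integral of a pair `(W, W̄')` the constant `W(1) W̄'(1) · vol`.

All statements are elementary consequences of the two equivariances. [folklore]

## References

* H. Jacquet, I. I. Piatetski-Shapiro, J. A. Shalika, *Rankin–Selberg convolutions*, Amer. J. Math.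
  105 (1983), §2, (2.7), p. 393 [JacquetPiatetskiShapiroShalika1983].
* C. Mœglin, J.-L. Waldspurger, *Le spectre résiduel de GL(n)*, Ann. Sci. ÉNS 22 (1989), Appendice,
  p. 667 [MoeglinWaldspurger1989].
-/

noncomputable section

open Matrix WithZero
open scoped MatrixGroups

namespace Literature.NumberTheory.Automorphic

namespace WhittakerSupport

variable {F : Type*} [Field F] [Valued F ℤᵐ⁰] {N : ℕ}

omit [Valued F ℤᵐ⁰] in
/-- Every element of `GL_N` lies in the improper corner `cornerGL N F N`. [folklore] -/
theorem mem_cornerGL_self (g : GL (Fin N) F) : g ∈ cornerGL N F N := by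
  intro i j hij
  rcases hij with hi | hj
  · exact absurd i.isLt (not_lt.2 hi)
  · exact absurd j.isLt (not_lt.2 hj)

/-- **Support theorem, level form.** Under the hypotheses `IsSpreadWhittaker ψ t M W`, with `ψ`
non-trivial somewhere on `{|x| ≤ exp(1 - c₀)}`, `M ≥ 1`, `|t_j| ≤ |t_i|` for `i ≤ j` and gaps
`exp(M - c₀) |t_{i+1}| ≤ |t_i|`: if `g` lies in the corner `GL_d ≤ GL_N` with `d < N` and `W(g) ≠ 0`,
then `g = u k` with `u ∈ N_N(F)`, `k ∈ K(𝔭^M)` and `W(y k) = W(y)` for every `y`. [folklore] -/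
theorem exists_eq_unipotent_mul_level_of_mem_cornerGL (ψ : AddChar F Circle) {c₀ M : ℤ}
    (hψ : ∃ x : F, Valued.v x ≤ exp (1 - c₀) ∧ ψ x ≠ 1) (hM₁ : 1 ≤ M)
    {t : Fin N → Fˣ} (hmono : ∀ i j : Fin N, i ≤ j → Valued.v (t j : F) ≤ Valued.v (t i : F))
    (hgap : ∀ i j : Fin N, (i : ℕ) + 1 = j → exp (M - c₀) * Valued.v (t j : F) ≤ Valued.v (t i : F))
    {W : GL (Fin N) F → ℂ} (hW : IsSpreadWhittaker ψ t M W) :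
    ∀ {d : ℕ} (_ : d < N) {g : GL (Fin N) F}, g ∈ cornerGL N F d → W g ≠ 0 →
      ∃ u ∈ upperUnitriangular (Fin N) F, ∃ k ∈ valuedCongruenceSubgroup (Fin N) (exp (-M)),
        (∀ y : GL (Fin N) F, W (y * k) = W y) ∧ g = u * k := by
  have ht0 : ∀ i, Valued.v (t i : F) ≠ 0 := fun i => (Valuation.ne_zero_iff _).2 (t i).ne_zero
  have hexpM : exp (-M) ≤ (1 : ℤᵐ⁰) := by rw [← exp_zero, exp_le_exp]; omega
  have hexpM1 : exp (-M) < (1 : ℤᵐ⁰) := by rw [← exp_zero, exp_lt_exp]; omega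
  intro d
  induction d with
  | zero =>
    intro _ g hg _
    refine ⟨1, one_mem _, 1, one_mem _, fun y => by rw [mul_one], ?_⟩
    rw [one_mul]
    refine Units.ext (Matrix.ext fun i j => ?_)
    rw [hg i j (Or.inl (Nat.zero_le _)), Units.val_one, Matrix.one_apply]
  | succ d ih =>
    intro hd g hg hne
    -- the row index `d` and the column index `d + 1`
    set iD : Fin N := ⟨d, by omega⟩ with hiD
    set jD : Fin N := ⟨d + 1, hd⟩ with hjD
    have hij : (iD : ℕ) + 1 = jD := rfl
    have hgE : ∀ l m : Fin N, (d + 1 ≤ (l : ℕ) ∨ d + 1 ≤ (m : ℕ)) →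
        (g : Matrix (Fin N) (Fin N) F) l m = if l = m then 1 else 0 := hg
    -- the deviation of the row `d` of `g` from the unit row
    set D : Fin N → F := fun m => (g : Matrix (Fin N) (Fin N) F) iD m - if iD = m then 1 else 0 with hD
    have hD0 : ∀ m : Fin N, ¬ (m : ℕ) ≤ d → D m = 0 := by
      intro m hm
      simp only [hD]
      rw [hgE iD m (Or.inr (by omega)), sub_self]
    -- Step 1: consistency of the left and right equivariances on the column group
    have hcons : ∀ i : Fin N, (i : ℕ) ≤ d → ∀ c : F, Valued.v c * Valued.v (t jD : F) ≤ Valued.v (t i : F) →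
        ψ (D i * c) = 1 := by
      intro i hi c hc
      have hijD : (i : ℕ) < jD := by change (i : ℕ) < d + 1; omega
      have hbT : ∀ l : Fin N, jD ≤ l → (Pi.single i c : Fin N → F) l = 0 := by
        intro l hl
        rw [Pi.single_apply, if_neg]
        intro h
        rw [h] at hl
        exact absurd (Fin.lt_def.2 hijD) (not_lt.2 hl)
      set b' : Fin N → F := (g : Matrix (Fin N) (Fin N) F) *ᵥ Pi.single i c with hb'
      have hb'apply : ∀ l, b' l = (g : Matrix (Fin N) (Fin N) F) l i * c := fun l => by
        simp only [hb', mulVec, dotProduct_single]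
      have hb'0 : ∀ l : Fin N, jD ≤ l → b' l = 0 := by
        intro l hl
        have hl' : d + 1 ≤ (l : ℕ) := hl
        rw [hb'apply, hgE l i (Or.inl hl'), if_neg, zero_mul]
        intro h
        rw [h] at hl'
        omega
      -- `g T = T' g`
      have hprod : g * colGL (Pi.single i c) jD (hbT jD le_rfl) = colGL b' jD (hb'0 jD le_rfl) * g := by
        refine Units.ext ?_
        change (g : Matrix (Fin N) (Fin N) F) * (1 + vecMulVec (Pi.single i c) (Pi.single jD 1)) =
          (1 + vecMulVec b' (Pi.single jD 1)) * g
        rw [hb']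
        refine mul_one_add_vecMulVec_eq _ _ _ ?_
        rw [single_one_vecMul]
        funext m
        change (g : Matrix (Fin N) (Fin N) F) jD m = (Pi.single jD (1 : F) : Fin N → F) m
        rw [hgE jD m (Or.inl le_rfl), Pi.single_apply]
        by_cases h : jD = m
        · rw [if_pos h, if_pos h.symm]
        · rw [if_neg h, if_neg (Ne.symm h)]
      -- the valuation bounds for `T`
      have hTbd : ∀ l m : Fin N, Valued.v (((colGL (Pi.single i c) jD (hbT jD le_rfl) : GL (Fin N) F) :
          Matrix (Fin N) (Fin N) F) l m * t m) ≤ Valued.v (t l : F) := by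
        intro l m
        rw [colGL_apply, Pi.single_apply]
        by_cases hlm : l = m
        · subst hlm
          rw [if_pos rfl]
          by_cases hlj : l = jD
          · rw [if_pos hlj, if_neg, add_zero, one_mul]
            intro hli
            rw [hli] at hlj
            exact absurd hlj.symm (ne_of_lt (Fin.lt_def.2 hijD)).symm
          · rw [if_neg hlj, add_zero, one_mul]
        · rw [if_neg hlm, zero_add]
          by_cases hmj : m = jD
          · rw [if_pos hmj]
            by_cases hli : l = i
            · rw [if_pos hli, hmj, hli, Valuation.map_mul]
              exact hc
            · rw [if_neg hli, zero_mul, Valuation.map_zero]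
              exact zero_le
          · rw [if_neg hmj, zero_mul, Valuation.map_zero]
            exact zero_le
      have h1 := hW.right _ (colGL_mem_upperUnitriangular _ jD hbT) hTbd g
      have h2 := hW.left _ (colGL_mem_upperUnitriangular _ jD hb'0) g
      rw [hprod] at h1
      rw [h1] at h2
      have h3 := mul_right_cancel₀ hne h2
      rw [whittakerCharFun_colGL ψ _ jD hbT iD hij, whittakerCharFun_colGL ψ _ jD hb'0 iD hij,
        Circle.coe_inj, hb'apply, Pi.single_apply] at h3
      have hDc : D i * c = (g : Matrix (Fin N) (Fin N) F) iD i * c - (if iD = i then c else 0) := by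
        simp only [hD]
        split_ifs <;> ring
      rw [hDc, AddChar.map_sub_eq_div, ← h3, div_self']
    -- Step 2: valuation bounds for the row `d` of `g`
    have hbound : ∀ i : Fin N, (i : ℕ) ≤ d → Valued.v (D i) * Valued.v (t i : F) ≤ exp (-M) * Valued.v (t iD : F) := by
      intro i hi
      have hA := valuation_mul_le_of_forall_addChar_eq_one ψ hψ (ht0 i) (ht0 jD) (hcons i hi)
      refine hA.trans ?_
      have hg' := hgap iD jD hij
      calc exp (-c₀) * Valued.v (t jD : F) = exp (-M) * (exp (M - c₀) * Valued.v (t jD : F)) := by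
            rw [← mul_assoc, ← exp_add]
            congr 2
            ring
        _ ≤ exp (-M) * Valued.v (t iD : F) := mul_le_mul_right hg' _
    have hDint : ∀ m : Fin N, Valued.v (D m) ≤ exp (-M) := by
      intro m
      by_cases hm : (m : ℕ) ≤ d
      · have hle : m ≤ iD := Fin.le_def.2 hm
        have h : Valued.v (D m) * Valued.v (t m : F) ≤ exp (-M) * Valued.v (t m : F) :=
          (hbound m hm).trans (mul_le_mul_right (hmono m iD hle) _)
        exact le_of_mul_le_mul_right h (zero_lt_iff.mpr (ht0 m))
      · rw [hD0 m hm, Valuation.map_zero]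
        exact zero_le
    have hDint1 : ∀ m : Fin N, Valued.v (D m) ≤ 1 := fun m => (hDint m).trans hexpM
    have hgdd : (g : Matrix (Fin N) (Fin N) F) iD iD = 1 + D iD := by
      simp only [hD]
      rw [if_pos trivial]
      ring
    have hvdd : Valued.v (1 + D iD) = 1 := Valuation.map_one_add_of_lt _ ((hDint iD).trans_lt hexpM1)
    have hk1 : 1 + D iD ≠ 0 := fun h => by
      rw [h, Valuation.map_zero] at hvdd
      exact zero_ne_one hvdd
    -- Step 3: the row matrix `k = 1 + e_d ⊗ D`; its row `d` is the row `d` of `g`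
    set k : GL (Fin N) F := rowGL D iD hk1 with hk
    have hkapply := rowGL_apply D iD hk1
    have hklevel : ∀ l m : Fin N,
        Valued.v ((((k : GL (Fin N) F) : Matrix (Fin N) (Fin N) F) - 1) l m * t m) ≤ exp (-M) * Valued.v (t l : F) := by
      intro l m
      rw [Matrix.sub_apply, hkapply, Matrix.one_apply, add_sub_cancel_left]
      by_cases hl : l = iD
      · rw [if_pos hl, hl]
        by_cases hm : (m : ℕ) ≤ d
        · rw [Valuation.map_mul]
          exact hbound m hm
        · rw [hD0 m hm, zero_mul, Valuation.map_zero]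
          exact zero_le
      · rw [if_neg hl, zero_mul, Valuation.map_zero]
        exact zero_le
    have hklevel' : ∀ l m : Fin N,
        Valued.v ((((k⁻¹ : GL (Fin N) F) : Matrix (Fin N) (Fin N) F) - 1) l m * t m) ≤ exp (-M) * Valued.v (t l : F) := by
      intro l m
      rw [Matrix.sub_apply, hk, rowGL_inv_apply, Matrix.one_apply, add_sub_cancel_left]
      by_cases hl : l = iD
      · rw [if_pos hl, hl, Valuation.map_mul, Valuation.map_mul, Valuation.map_neg, map_inv₀, hvdd,
          inv_one, one_mul, ← Valuation.map_mul]
        by_cases hm : (m : ℕ) ≤ d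
        · rw [Valuation.map_mul]
          exact hbound m hm
        · rw [hD0 m hm, zero_mul, Valuation.map_zero]
          exact zero_le
      · rw [if_neg hl, zero_mul, Valuation.map_zero]
        exact zero_le
    -- `k ∈ K(𝔭^M)`
    have hkK : k ∈ valuedCongruenceSubgroup (Fin N) (exp (-M)) := by
      refine ⟨fun l m => ?_, fun l m => ?_, fun l m => ?_⟩
      · rw [hkapply]
        refine Valuation.map_add_le _ ?_ ?_
        · split_ifs <;> simp
        · split_ifs
          · exact hDint1 m
          · simp
      · rw [hk, rowGL_inv_apply]
        refine Valuation.map_add_le _ ?_ ?_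
        · split_ifs <;> simp
        · split_ifs
          · rw [Valuation.map_mul, Valuation.map_neg, map_inv₀, hvdd, inv_one, one_mul]
            exact hDint1 m
          · simp
      · rw [Matrix.sub_apply, hkapply, Matrix.one_apply, add_sub_cancel_left]
        split_ifs
        · exact hDint m
        · simp
    -- `k` is invisible to `W`
    have hkW : ∀ y : GL (Fin N) F, W (y * k) = W y := fun y => hW.level k hklevel hklevel' y
    have hkcorner : k ∈ cornerGL N F (d + 1) := by
      intro l m hlm
      rw [hkapply]
      rcases hlm with hl | hm
      · have hliD : l ≠ iD := by
          intro h
          rw [h] at hl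
          change d + 1 ≤ d at hl
          omega
        rw [if_neg hliD, add_zero]
      · by_cases hl : l = iD
        · rw [if_pos hl, hD0 m (by omega), add_zero]
        · rw [if_neg hl, add_zero]
    -- `p = g k⁻¹` lies in the corner, has unit row `d`, and `W p ≠ 0`
    have hp : g * k⁻¹ ∈ cornerGL N F (d + 1) := mul_mem hg (inv_mem hkcorner)
    have hprow : ∀ m : Fin N, ((g * k⁻¹ : GL (Fin N) F) : Matrix (Fin N) (Fin N) F) iD m =
        if iD = m then 1 else 0 := by
      intro m
      have hrowk : ∀ x : Fin N, (g : Matrix (Fin N) (Fin N) F) iD x =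
          ((k : GL (Fin N) F) : Matrix (Fin N) (Fin N) F) iD x := by
        intro x
        rw [hkapply, if_pos rfl]
        simp only [hD]
        ring
      rw [Units.val_mul, Matrix.mul_apply]
      simp_rw [hrowk]
      rw [← Matrix.mul_apply, ← Units.val_mul, mul_inv_cancel, Units.val_one, Matrix.one_apply]
    have hWp : W (g * k⁻¹) ≠ 0 := by
      have h := hkW (g * k⁻¹)
      rw [inv_mul_cancel_right] at h
      rwa [h] at hne
    -- Step 4: split off the corner `GL_d` and apply the induction hypothesis
    obtain ⟨b, hb, c, hc, hpc⟩ := exists_colGL_mul_of_row_eq iD rfl hp hprow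
    have hWc : W c ≠ 0 := by
      have h := hW.left (colGL b iD (hb _ le_rfl)) (colGL_mem_upperUnitriangular b iD hb) c
      rw [← hpc] at h
      intro h0
      rw [h0, mul_zero] at h
      exact hWp h
    obtain ⟨u', hu', k', hk', hk'W, hck⟩ := ih (by omega) hc hWc
    refine ⟨colGL b iD (hb _ le_rfl) * u', mul_mem (colGL_mem_upperUnitriangular b iD hb) hu',
      k' * k, mul_mem hk' hkK, fun y => ?_, ?_⟩
    · rw [← mul_assoc, hkW, hk'W]
    · calc g = g * k⁻¹ * k := by rw [inv_mul_cancel_right]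
        _ = colGL b iD (hb _ le_rfl) * c * k := by rw [hpc]
        _ = colGL b iD (hb _ le_rfl) * u' * (k' * k) := by rw [hck]; simp only [mul_assoc]

/-- **Support theorem at the points selected by a thin test function (level form).** Let `N = n + 1`
and keep the hypotheses of `exists_eq_unipotent_mul_level_of_mem_cornerGL`; let `m₀` satisfy
`exp(-m₀) |t₀| ≤ exp(-M) |t_n|`. If the last row of `g ∈ GL_{n+1}(F)` is `≡ e_{n+1} (mod 𝔭^{m₀})`
(the condition `Φ_v(e_{n+1} g) ≠ 0` for `Φ_v = 𝟙_{e_{n+1} + 𝔭^{m₀} 𝒪^{n+1}}`) and `W(g) ≠ 0`, then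
`g = u k` with `u ∈ N_{n+1}(F)`, `k ∈ K(𝔭^M)` and `W(y k) = W(y)` for every `y`. Proof: the row
matrix `κ = 1 + e_n ⊗ (g_{n,·} - e_n)` lies in the level set of `W` and in `K(𝔭^M)`, `g κ⁻¹` has last
row `e_n`, hence splits as (column unipotent) × (corner `GL_n` element), to which the corner theorem
applies. [folklore] -/
theorem exists_eq_unipotent_mul_level_of_lastRow {n : ℕ} (ψ : AddChar F Circle) {c₀ M : ℤ}
    (hψ : ∃ x : F, Valued.v x ≤ exp (1 - c₀) ∧ ψ x ≠ 1) (hM₁ : 1 ≤ M)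
    {t : Fin (n + 1) → Fˣ} (hmono : ∀ i j : Fin (n + 1), i ≤ j → Valued.v (t j : F) ≤ Valued.v (t i : F))
    (hgap : ∀ i j : Fin (n + 1), (i : ℕ) + 1 = j → exp (M - c₀) * Valued.v (t j : F) ≤ Valued.v (t i : F))
    {W : GL (Fin (n + 1)) F → ℂ} (hW : IsSpreadWhittaker ψ t M W)
    {m₀ : ℤ} (hm₀ : exp (-m₀) * Valued.v (t 0 : F) ≤ exp (-M) * Valued.v (t (Fin.last n) : F))
    {g : GL (Fin (n + 1)) F}
    (hlast : ∀ m : Fin (n + 1),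
      Valued.v ((g : Matrix (Fin (n + 1)) (Fin (n + 1)) F) (Fin.last n) m - if Fin.last n = m then 1 else 0) ≤ exp (-m₀))
    (hne : W g ≠ 0) :
    ∃ u ∈ upperUnitriangular (Fin (n + 1)) F, ∃ k ∈ valuedCongruenceSubgroup (Fin (n + 1)) (exp (-M)),
      (∀ y : GL (Fin (n + 1)) F, W (y * k) = W y) ∧ g = u * k := by
  set L : Fin (n + 1) := Fin.last n with hL
  have ht0 : ∀ i, Valued.v (t i : F) ≠ 0 := fun i => (Valuation.ne_zero_iff _).2 (t i).ne_zero
  have hexpM : exp (-M) ≤ (1 : ℤᵐ⁰) := by rw [← exp_zero, exp_le_exp]; omega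
  have hexpM1 : exp (-M) < (1 : ℤᵐ⁰) := by rw [← exp_zero, exp_lt_exp]; omega
  -- `exp(-m₀) ≤ exp(-M) < 1`
  have hm₀M : exp (-m₀) ≤ exp (-M) := by
    have h : exp (-m₀) * Valued.v (t 0 : F) ≤ exp (-M) * Valued.v (t 0 : F) :=
      hm₀.trans (mul_le_mul_right (hmono 0 L (Fin.zero_le _)) _)
    exact le_of_mul_le_mul_right h (zero_lt_iff.mpr (ht0 0))
  -- the deviation of the last row from `e_n`
  set D' : Fin (n + 1) → F := fun m => (g : Matrix (Fin (n + 1)) (Fin (n + 1)) F) L m -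
    if L = m then 1 else 0 with hD'
  have hD'v : ∀ m, Valued.v (D' m) ≤ exp (-m₀) := fun m => hlast m
  have hD'M : ∀ m, Valued.v (D' m) ≤ exp (-M) := fun m => (hD'v m).trans hm₀M
  have hD'1 : ∀ m, Valued.v (D' m) ≤ 1 := fun m => (hD'M m).trans hexpM
  have hvLL : Valued.v (1 + D' L) = 1 := Valuation.map_one_add_of_lt _ ((hD'M L).trans_lt hexpM1)
  have hκ1 : 1 + D' L ≠ 0 := fun h => by
    rw [h, Valuation.map_zero] at hvLL
    exact zero_ne_one hvLL
  -- the row matrix `κ = 1 + e_n ⊗ D'`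
  set κ : GL (Fin (n + 1)) F := rowGL D' L hκ1 with hκ
  have hκapply := rowGL_apply D' L hκ1
  have hκlevel : ∀ l m : Fin (n + 1),
      Valued.v ((((κ : GL (Fin (n + 1)) F) : Matrix (Fin (n + 1)) (Fin (n + 1)) F) - 1) l m * t m) ≤
        exp (-M) * Valued.v (t l : F) := by
    intro l m
    rw [Matrix.sub_apply, hκapply, Matrix.one_apply, add_sub_cancel_left]
    by_cases hl : l = L
    · rw [if_pos hl, hl, Valuation.map_mul]
      calc Valued.v (D' m) * Valued.v (t m : F) ≤ exp (-m₀) * Valued.v (t 0 : F) :=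
            mul_le_mul' (hD'v m) (hmono 0 m (Fin.zero_le _))
        _ ≤ exp (-M) * Valued.v (t L : F) := hm₀
    · rw [if_neg hl, zero_mul, Valuation.map_zero]
      exact zero_le
  have hκlevel' : ∀ l m : Fin (n + 1),
      Valued.v ((((κ⁻¹ : GL (Fin (n + 1)) F) : Matrix (Fin (n + 1)) (Fin (n + 1)) F) - 1) l m * t m) ≤
        exp (-M) * Valued.v (t l : F) := by
    intro l m
    rw [Matrix.sub_apply, hκ, rowGL_inv_apply, Matrix.one_apply, add_sub_cancel_left]
    by_cases hl : l = L
    · rw [if_pos hl, hl, Valuation.map_mul, Valuation.map_mul, Valuation.map_neg, map_inv₀, hvLL,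
        inv_one, one_mul, ← Valuation.map_mul, Valuation.map_mul]
      calc Valued.v (D' m) * Valued.v (t m : F) ≤ exp (-m₀) * Valued.v (t 0 : F) :=
            mul_le_mul' (hD'v m) (hmono 0 m (Fin.zero_le _))
        _ ≤ exp (-M) * Valued.v (t L : F) := hm₀
    · rw [if_neg hl, zero_mul, Valuation.map_zero]
      exact zero_le
  have hκK : κ ∈ valuedCongruenceSubgroup (Fin (n + 1)) (exp (-M)) := by
    refine ⟨fun l m => ?_, fun l m => ?_, fun l m => ?_⟩
    · rw [hκapply]
      refine Valuation.map_add_le _ ?_ ?_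
      · split_ifs <;> simp
      · split_ifs
        · exact hD'1 m
        · simp
    · rw [hκ, rowGL_inv_apply]
      refine Valuation.map_add_le _ ?_ ?_
      · split_ifs <;> simp
      · split_ifs
        · rw [Valuation.map_mul, Valuation.map_neg, map_inv₀, hvLL, inv_one, one_mul]
          exact hD'1 m
        · simp
    · rw [Matrix.sub_apply, hκapply, Matrix.one_apply, add_sub_cancel_left]
      split_ifs
      · exact hD'M m
      · simp
  have hκW : ∀ y : GL (Fin (n + 1)) F, W (y * κ) = W y := fun y => hW.level κ hκlevel hκlevel' y
  -- `p = g κ⁻¹` has last row `e_n` and `W p ≠ 0`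
  have hprow : ∀ m : Fin (n + 1), ((g * κ⁻¹ : GL (Fin (n + 1)) F) : Matrix (Fin (n + 1)) (Fin (n + 1)) F) L m =
      if L = m then 1 else 0 := by
    intro m
    have hrowk : ∀ x : Fin (n + 1), (g : Matrix (Fin (n + 1)) (Fin (n + 1)) F) L x =
        ((κ : GL (Fin (n + 1)) F) : Matrix (Fin (n + 1)) (Fin (n + 1)) F) L x := by
      intro x
      rw [hκapply, if_pos rfl]
      simp only [hD']
      ring
    rw [Units.val_mul, Matrix.mul_apply]
    simp_rw [hrowk]
    rw [← Matrix.mul_apply, ← Units.val_mul, mul_inv_cancel, Units.val_one, Matrix.one_apply]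
  have hWp : W (g * κ⁻¹) ≠ 0 := by
    have h := hκW (g * κ⁻¹)
    rw [inv_mul_cancel_right] at h
    rwa [h] at hne
  -- split off the corner `GL_n` and apply the corner theorem
  obtain ⟨b, hb, c, hc, hpc⟩ :=
    exists_colGL_mul_of_row_eq (d := n) L rfl (mem_cornerGL_self (g * κ⁻¹)) hprow
  have hWc : W c ≠ 0 := by
    have h := hW.left (colGL b L (hb _ le_rfl)) (colGL_mem_upperUnitriangular b L hb) c
    rw [← hpc] at h
    intro h0
    rw [h0, mul_zero] at h
    exact hWp h
  obtain ⟨u', hu', k', hk', hk'W, hck⟩ :=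
    exists_eq_unipotent_mul_level_of_mem_cornerGL ψ hψ hM₁ hmono hgap hW (Nat.lt_succ_self n) hc hWc
  refine ⟨colGL b L (hb _ le_rfl) * u', mul_mem (colGL_mem_upperUnitriangular b L hb) hu',
    k' * κ, mul_mem hk' hκK, fun y => ?_, ?_⟩
  · rw [← mul_assoc, hκW, hk'W]
  · calc g = g * κ⁻¹ * κ := by rw [inv_mul_cancel_right]
      _ = colGL b L (hb _ le_rfl) * c * κ := by rw [hpc]
      _ = colGL b L (hb _ le_rfl) * u' * (k' * κ) := by rw [hck]; simp only [mul_assoc]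

omit [Valued F ℤᵐ⁰] in
/-- **The value of a second function at a point `g = u k`**: if `W'` is left `ψ_N`-equivariant and
right invariant under `k`, then `W'(u k) = ψ_N(u) W'(1)`. (Used with `k ∈ K(𝔭^M)` for a function of
level `K(𝔭^M)`.) [folklore] -/
theorem apply_eq_whittakerCharFun_mul_apply_one_of_eq_mul (ψ : AddChar F Circle) {W' : GL (Fin N) F → ℂ}
    (hleft : ∀ (u : GL (Fin N) F) (hu : u ∈ upperUnitriangular (Fin N) F) (g : GL (Fin N) F),
      W' (u * g) = whittakerCharFun ψ ⟨u, hu⟩ * W' g)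
    {u k g : GL (Fin N) F} (hu : u ∈ upperUnitriangular (Fin N) F) (hk : ∀ y : GL (Fin N) F, W' (y * k) = W' y)
    (hg : g = u * k) : W' g = whittakerCharFun ψ ⟨u, hu⟩ * W' 1 := by
  rw [hg, hleft u hu k, ← one_mul k, hk 1]

/-- **On the thin set a spread Whittaker function is `W(1)` times a unitary phase.** Under the
hypotheses of `exists_eq_unipotent_mul_level_of_lastRow`, `W(g) = ψ_N(u) W(1)` for the unipotent `u`
produced there; in particular `W(1) ≠ 0`. [folklore] -/
theorem apply_eq_whittakerCharFun_mul_apply_one_of_lastRow {n : ℕ} (ψ : AddChar F Circle) {c₀ M : ℤ}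
    (hψ : ∃ x : F, Valued.v x ≤ exp (1 - c₀) ∧ ψ x ≠ 1) (hM₁ : 1 ≤ M)
    {t : Fin (n + 1) → Fˣ} (hmono : ∀ i j : Fin (n + 1), i ≤ j → Valued.v (t j : F) ≤ Valued.v (t i : F))
    (hgap : ∀ i j : Fin (n + 1), (i : ℕ) + 1 = j → exp (M - c₀) * Valued.v (t j : F) ≤ Valued.v (t i : F))
    {W : GL (Fin (n + 1)) F → ℂ} (hW : IsSpreadWhittaker ψ t M W)
    {m₀ : ℤ} (hm₀ : exp (-m₀) * Valued.v (t 0 : F) ≤ exp (-M) * Valued.v (t (Fin.last n) : F))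
    {g : GL (Fin (n + 1)) F}
    (hlast : ∀ m : Fin (n + 1),
      Valued.v ((g : Matrix (Fin (n + 1)) (Fin (n + 1)) F) (Fin.last n) m - if Fin.last n = m then 1 else 0) ≤ exp (-m₀))
    (hne : W g ≠ 0) :
    ∃ u ∈ upperUnitriangular (Fin (n + 1)) F, ∃ k ∈ valuedCongruenceSubgroup (Fin (n + 1)) (exp (-M)),
      (∀ y : GL (Fin (n + 1)) F, W (y * k) = W y) ∧ g = u * k ∧
      ∀ hu : u ∈ upperUnitriangular (Fin (n + 1)) F, W g = whittakerCharFun ψ ⟨u, hu⟩ * W 1 := by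
  obtain ⟨u, hu, k, hk, hkW, hg⟩ := exists_eq_unipotent_mul_level_of_lastRow ψ hψ hM₁ hmono hgap hW hm₀ hlast hne
  exact ⟨u, hu, k, hk, hkW, hg, fun hu' => apply_eq_whittakerCharFun_mul_apply_one_of_eq_mul ψ hW.left hu' hkW hg⟩

end WhittakerSupport

end Literature.NumberTheory.Automorphic
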